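import Literature.NumberTheory.EllipticCurves.LangTorsorGeometric
import Literature.NumberTheory.DiophantineGeometry.FunctionFieldArtinSchreierSplitting
import Literature.NumberTheory.DiophantineGeometry.FunctionFieldOnePointData
import Literature.NumberTheory.DiophantineGeometry.FunctionFieldFundamentalEquality
import HarnessLib

/-!
# Frobenius elements of the Lang–Artin–Schreier covering `L / k(W)`

Topic `NumberTheory/EllipticCurves`. For an elliptic curve `W` over a finite field `k` of
characteristic `p`, `K₁ = k(W)`, the Lang cover `LangCover W` (`= k(W)` through `λ`) and its
Artin–Schreier layer `L = LangASCover W p g₁ = LangCover W (ϑ)`, `ϑ^p - ϑ = λ g₁`, with Galois group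
`G ≅ E(k) × ℤ/p` (`LangArtinSchreierCover`), this file computes the Frobenius elements of `L/K₁` at
the finite places and the full constant field of `L`:

* `gen_mem` (`ϑ` is integral where `g₁` is), **`asComp_frob`** — the Artin–Schreier component of the
  Frobenius at a place above `v` is `Tr_{κ(v)/𝔽_p}(g₁(v))` (from `Frob ϑ ≡ ϑ^{#κ(v)}` and
  `ϑ^{p^e} - ϑ = Σ_{i<e} g₁^{p^i}`);
* `liesOver_of_restrict_eq`, **`inertia_eq_bot`** (`L/K₁` is unramified at the places above the
  finite places `v`: the Lang layer by `LangTorsorGeometric.transl_eq_zero_of_forall`, the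
  Artin–Schreier layer because `θ ϑ - ϑ ∈ 𝔽_p` is a unit unless it is `0`), and
  **`frob_eq_sigma`**: `Frob_𝔔 = σ_{(T_v, Tr_{κ(v)/𝔽_p} g₁(v))}` with `T_v = langPt v` the Lang–Artin
  point (`LangTorsorGeometric.frob_coverPlace_eq_transl_langPt`, `restrictNormal_frob`);
* **`isIntegrallyClosedIn`**: if `ord_∞(λ g₁) = -m` with `p ∤ m` then the place of `L` above the
  rational place `∞` of `LangCover W` is totally ramified, hence rational, so `k` is the full
  constant field of `L` (tree: `totallyRamified_of_pow_sub_eq_of_coprime`,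
  `isIntegrallyClosedIn_of_isRational`).

Everything is proved; no named facts.

## References

* D. R. Kohel, I. E. Shparlinski, *On exponential sums and group generators for elliptic curves over
  finite fields*, ANTS-IV, LNCS 1838 (2000), §2. [KohelShparlinski2000]
* H. Stichtenoth, *Algebraic Function Fields and Codes*, 2nd ed., GTM 254, Prop. 3.7.8, Thm. 3.8.2.
  [Stichtenoth2009]
* J. H. Silverman, *The Arithmetic of Elliptic Curves*, 2nd ed., GTM 106, III.4.10(b). [SilvermanAEC2009]
-/

noncomputable section

open scoped Classical
open Polynomial WeierstrassCurve
open Literature.NumberTheory.EllipticCurves.WeierstrassGeometricPlaces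
open Literature.NumberTheory.EllipticCurves.WeierstrassGeometricOrders
open Literature.NumberTheory.EllipticCurves.LangTorsorGeometric

universe u

namespace Literature.NumberTheory.EllipticCurves.LangTorsor

open Literature.FieldTheory.ArtinSchreier Literature.NumberTheory.DiophantineGeometry
open AlgFunctionField
open scoped IntermediateField

variable {F : Type u} [Field F] [Fintype F] [DecidableEq F] (W : WeierstrassCurve F) [W.IsElliptic]
variable (p : ℕ) [Fact p.Prime] [CharP F p] (g₁ : W.toAffine.FunctionField)
variable [Fact (∀ s : LangCover W, s ^ p - s ≠ algebraMap W.toAffine.FunctionField (LangCover W) g₁)]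

namespace LangASCover

/-! ### The Artin–Schreier component of the Frobenius elements (Kohel–Shparlinski §2) -/

section ASFrobenius

/-- `k → k(W) → L` is a scalar tower. [folklore] -/
instance isScalarTower_base : IsScalarTower F W.toAffine.FunctionField (LangASCover W p g₁) :=
  IsScalarTower.of_algebraMap_eq fun c => by
    rw [IsScalarTower.algebraMap_apply F (LangCover W) (LangASCover W p g₁),
      IsScalarTower.algebraMap_apply F W.toAffine.FunctionField (LangCover W),
      ← IsScalarTower.algebraMap_apply W.toAffine.FunctionField (LangCover W) (LangASCover W p g₁)]

/-- `L` has characteristic `p`. [folklore] -/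
instance charP : CharP (LangASCover W p g₁) p :=
  charP_of_injective_algebraMap (algebraMap (LangCover W) _).injective p

/-- The Artin–Schreier equation in `L`: `ϑ^p - ϑ = g₁`. [cite: Stichtenoth2009, Prop. 3.7.8] -/
theorem gen_pow_sub_gen :
    gen W p g₁ ^ p - gen W p g₁ = algebraMap W.toAffine.FunctionField (LangASCover W p g₁) g₁ := by
  rw [IsScalarTower.algebraMap_apply W.toAffine.FunctionField (LangCover W) (LangASCover W p g₁)]
  exact root_pow_sub_root

/-- **`ϑ` is integral at every place where `g₁` is**: if `v_Q(ϑ) > 1`... i.e. `ϑ ∉ 𝒪_Q`, then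
`v_Q(ϑ^p - ϑ) = v_Q(ϑ)^p > 1`, contradicting `ϑ^p - ϑ = g₁ ∈ 𝒪_Q`. [cite: Stichtenoth2009, Prop. 3.7.8] -/
theorem gen_mem (Q : PlaceOver F (LangASCover W p g₁))
    (hg : algebraMap W.toAffine.FunctionField (LangASCover W p g₁) g₁ ∈ Q.toValuationSubring) :
    gen W p g₁ ∈ Q.toValuationSubring := by
  by_contra hz
  have hp : p.Prime := Fact.out
  set z := gen W p g₁ with hzdef
  have h1 : 1 < Q.valuation z := not_le.1 (mt (Q.toValuationSubring.valuation_le_one_iff z).1 hz)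
  have h2 : Q.valuation z < Q.valuation (z ^ p) := by
    rw [Valuation.map_pow]; exact lt_self_pow₀ h1 hp.one_lt
  have h3 : Q.valuation (z ^ p - z) = Q.valuation (z ^ p) := by
    rw [sub_eq_add_neg]
    refine Valuation.map_add_eq_of_lt_left Q.valuation ?_
    rwa [Valuation.map_neg]
  have h4 : Q.valuation (z ^ p - z) ≤ 1 := (Q.toValuationSubring.valuation_le_one_iff _).2 (by
    rw [hzdef, gen_pow_sub_gen]; exact hg)
  rw [h3] at h4
  exact (lt_irrefl _) ((h1.trans h2).trans_le h4)

/-- `z^{p^e} - z = Σ_{i<e} (z^p - z)^{p^i}` in characteristic `p`. [folklore] -/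
theorem pow_pow_sub_self_eq_sum {R : Type*} [CommRing R] [CharP R p] (z : R) (e : ℕ) :
    z ^ p ^ e - z = ∑ i ∈ Finset.range e, (z ^ p - z) ^ p ^ i := by
  have h : ∀ i, (z ^ p - z) ^ p ^ i = z ^ p ^ (i + 1) - z ^ p ^ i := fun i => by
    rw [sub_pow_char_pow, ← pow_mul, ← pow_succ']
  simp_rw [h]
  rw [Finset.sum_range_sub (fun i => z ^ p ^ i), pow_zero, pow_one]

omit [Fintype F] [DecidableEq F] [W.IsElliptic] [Fact p.Prime] [CharP F p] in
/-- Membership in the maximal ideal transfers along a place extension `Q | P`.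
[cite: Stichtenoth2009, Def. 3.1.3] -/
theorem valuation_algebraMap_lt_one_iff {M : Type*} [Field M] [Algebra W.toAffine.FunctionField M]
    [Algebra F M] (Q : PlaceOver F M) {P : PlaceOver F W.toAffine.FunctionField}
    (hQP : ∀ x : W.toAffine.FunctionField,
      algebraMap W.toAffine.FunctionField M x ∈ Q.toValuationSubring ↔ x ∈ P.toValuationSubring)
    (x : W.toAffine.FunctionField) :
    Q.valuation (algebraMap W.toAffine.FunctionField M x) < 1 ↔ P.valuation x < 1 := by
  by_cases hx : x = 0
  · simp [hx]
  rw [valuation_lt_one_iff_inv_notMem Q.toValuationSubring ((_root_.map_ne_zero _).2 hx),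
    valuation_lt_one_iff_inv_notMem P.toValuationSubring hx, ← map_inv₀, hQP]

/-- The residue field of a place of `k(W)/k` has characteristic `p`. [folklore] -/
instance charP_residueField (P : PlaceOver F W.toAffine.FunctionField) : CharP P.residueField p :=
  charP_of_injective_algebraMap (algebraMap F P.residueField).injective p

/-- **The Artin–Schreier component of the Frobenius** at a place `Q` of `L` above a place `P` of
`k(W)` where `g₁` is regular: `Frob_Q(ϑ) = ϑ + Tr_{κ(P)/𝔽_p}(g₁ mod P)`, i.e.
`asComp (Frob_Q) = Tr_{κ(P)/𝔽_p}(ḡ₁)` — from `Frob_Q ϑ ≡ ϑ^{#κ(P)} (mod Q)` and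
`ϑ^{p^e} - ϑ = Σ_{i<e} g₁^{p^i} ≡ Tr(ḡ₁)` (`#κ(P) = p^e`). This is the computation behind
"`ψ(f(P))` is the value of the Artin–Schreier character at the Frobenius of `P`".
[cite: KohelShparlinski2000, §2] [cite: Stichtenoth2009, Prop. 3.7.8 and Thm. 3.8.2] -/
theorem asComp_frob {P : PlaceOver F W.toAffine.FunctionField} (hg : g₁ ∈ P.toValuationSubring)
    (Q : PlaceOver F (LangASCover W p g₁))
    (hQP : ∀ x : W.toAffine.FunctionField,
      algebraMap W.toAffine.FunctionField (LangASCover W p g₁) x ∈ Q.toValuationSubring ↔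
        x ∈ P.toValuationSubring)
    [Algebra (ZMod p) P.residueField] :
    asComp W p g₁ (PlaceOver.frob Q hQP) =
      Multiplicative.ofAdd (Algebra.trace (ZMod p) P.residueField
        (IsLocalRing.residue P.toValuationSubring ⟨g₁, hg⟩)) := by
  haveI : NeZero p := ⟨(Fact.out : p.Prime).ne_zero⟩
  haveI := P.finite_residueField
  set θ := PlaceOver.frob Q hQP with hθ
  set z := gen W p g₁ with hz
  set g : LangASCover W p g₁ := algebraMap W.toAffine.FunctionField (LangASCover W p g₁) g₁ with hgL
  set n : ℕ := (asComp W p g₁ θ).toAdd.val with hn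
  -- `#κ(P) = p^e`
  set e : ℕ := Module.finrank (ZMod p) P.residueField with he
  have hN : Nat.card P.residueField = p ^ e := by
    have h := Module.natCard_eq_pow_finrank (K := ZMod p) (V := P.residueField)
    rwa [Nat.card_zmod] at h
  -- the congruence `θ z ≡ z^N (mod Q)` with `θ z = z + n`
  have hzQ : z ∈ Q.toValuationSubring := gen_mem W p g₁ Q ((hQP g₁).2 hg)
  have hcong := PlaceOver.valuation_frob_sub_pow_lt_one Q hQP hzQ
  rw [← hθ, hN, show θ z = z + (n : LangASCover W p g₁) from apply_gen W p g₁ θ] at hcong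
  -- `z^{p^e} - z = Σ g^{p^i}`
  have hsum : z ^ p ^ e - z = ∑ i ∈ Finset.range e, g ^ p ^ i := by
    rw [pow_pow_sub_self_eq_sum p z e]
    refine Finset.sum_congr rfl fun i _ => ?_
    rw [hz, gen_pow_sub_gen]
  have hdiff : z + (n : LangASCover W p g₁) - z ^ p ^ e =
      algebraMap W.toAffine.FunctionField (LangASCover W p g₁)
        ((n : W.toAffine.FunctionField) - ∑ i ∈ Finset.range e, g₁ ^ p ^ i) := by
    rw [map_sub, map_natCast, map_sum]
    simp_rw [map_pow]
    rw [← hgL, ← hsum]; ring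
  rw [hdiff, valuation_algebraMap_lt_one_iff W Q hQP] at hcong
  -- read in `κ(P)`
  have hres : IsLocalRing.residue P.toValuationSubring
      ⟨(n : W.toAffine.FunctionField) - ∑ i ∈ Finset.range e, g₁ ^ p ^ i,
        (P.toValuationSubring.valuation_le_one_iff _).1 hcong.le⟩ = 0 := by
    rw [IsLocalRing.residue_eq_zero_iff, ValuationSubring.valuation_lt_one_iff]
    exact hcong
  have hres' : (n : P.residueField) = ∑ i ∈ Finset.range e,
      (IsLocalRing.residue P.toValuationSubring ⟨g₁, hg⟩) ^ p ^ i := by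
    rw [← sub_eq_zero, ← hres]
    have hmem : ∀ i, g₁ ^ p ^ i ∈ P.toValuationSubring := fun i => pow_mem hg _
    rw [show (⟨(n : W.toAffine.FunctionField) - ∑ i ∈ Finset.range e, g₁ ^ p ^ i,
        (P.toValuationSubring.valuation_le_one_iff _).1 hcong.le⟩ : P.toValuationSubring) =
        (n : P.toValuationSubring) - ∑ i ∈ Finset.range e, (⟨g₁, hg⟩ : P.toValuationSubring) ^ p ^ i
        from Subtype.ext (by push_cast; rfl)]
    rw [map_sub, map_natCast, map_sum]
    simp_rw [map_pow]
  have htr := FiniteField.algebraMap_trace_eq_sum_pow (ZMod p) P.residueField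
    (IsLocalRing.residue P.toValuationSubring ⟨g₁, hg⟩)
  rw [Nat.card_zmod, ← he, ← hres', ← map_natCast (algebraMap (ZMod p) P.residueField) n] at htr
  have hinj := (algebraMap (ZMod p) P.residueField).injective htr
  apply Multiplicative.toAdd.injective
  rw [toAdd_ofAdd, hinj, hn, ZMod.natCast_zmod_val]

end ASFrobenius

/-! ### Frobenius elements of `L/k(W)` at the places above the finite places -/

section Frobenius

variable (σ : Field.absoluteGaloisGroup F) (hσ : ∀ x : AlgebraicClosure F, σ • x = x ^ Fintype.card F)

/-- `k → LangCover W → L` is a scalar tower. [folklore] -/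
instance isScalarTower_base_cover : IsScalarTower F (LangCover W) (LangASCover W p g₁) :=
  IsScalarTower.of_algebraMap_eq fun _ => rfl

include hσ in
/-- A place `𝔔` of `L` whose restriction to the Lang cover is the place below the geometric point
`P` lies over the place of `k(W)` below `ϖ(P) = σP - P`. [cite: KohelShparlinski2000, §2] -/
theorem liesOver_of_restrict_eq {P : W.geomPoints} (hP : P ≠ 0) (hσP : σ • P ≠ P)
    (𝔔 : PlaceOver F (LangASCover W p g₁))
    (h𝔔 : 𝔔.restrict (K := F) (F := LangCover W) = coverPlace W P) :
    ∀ x : W.toAffine.FunctionField, algebraMap W.toAffine.FunctionField (LangASCover W p g₁) x ∈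
      𝔔.toValuationSubring ↔ x ∈ (belowPlace W (σ • P - P)).toValuationSubring := fun x => by
  rw [IsScalarTower.algebraMap_apply W.toAffine.FunctionField (LangCover W) (LangASCover W p g₁),
    ← PlaceOver.mem_restrict_iff (K := F), h𝔔]
  exact coverPlace_liesOver W σ hσ hP hσP x

omit [Fintype F] [DecidableEq F] [W.IsElliptic] [Fact p.Prime] [CharP F p] in
/-- Frobenius elements at equal places agree. [folklore] -/
theorem _root_.Literature.NumberTheory.DiophantineGeometry.AlgFunctionField.PlaceOver.frob_congr
    {k : Type*} {L' : Type*} [Field k] [Finite k] [Field L'] [Algebra k L'] [IsAlgFunctionField k L']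
    {Ω : Type*} [Field Ω] [Algebra L' Ω] {P' : PlaceOver k L'} [FiniteDimensional L' Ω]
    [Algebra.IsSeparable L' Ω] [IsGalois L' Ω] {K' : Type*} [Field K'] [Finite K'] [Algebra K' Ω]
    [IsAlgFunctionField K' Ω] {Q Q' : PlaceOver K' Ω} (h : Q = Q')
    (hQP : ∀ x : L', algebraMap L' Ω x ∈ Q.toValuationSubring ↔ x ∈ P'.toValuationSubring)
    (hQP' : ∀ x : L', algebraMap L' Ω x ∈ Q'.toValuationSubring ↔ x ∈ P'.toValuationSubring) :
    PlaceOver.frob Q hQP = PlaceOver.frob Q' hQP' := by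
  subst h; rfl

set_option synthInstance.maxHeartbeats 400000 in
include hσ in
/-- **`L/k(W)` is unramified at the places above the finite places**: the inertia group of a place
`𝔔` of `L` restricting to the place of the Lang cover below `P` (`P ≠ O`, `σP ≠ P`, `g₁` regular at
the place below `σP - P`) is trivial — an inertia element restricts to an inertia element of the
Lang cover (trivial: `transl_eq_zero_of_forall`), so lies in the Artin–Schreier group, and
`θ ϑ - ϑ ∈ 𝔽_p` is a unit unless `0`. [cite: Stichtenoth2009, Prop. 3.7.8 and Thm. 3.8.2]
[cite: KohelShparlinski2000, §2] -/
theorem inertia_eq_bot {P : W.geomPoints} (hP : P ≠ 0) (hσP : σ • P ≠ P)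
    (𝔔 : PlaceOver F (LangASCover W p g₁))
    (h𝔔 : 𝔔.restrict (K := F) (F := LangCover W) = coverPlace W P)
    (hg : g₁ ∈ (belowPlace W (σ • P - P)).toValuationSubring) :
    (PlaceOver.primeBelow 𝔔 (liesOver_of_restrict_eq W p g₁ σ hσ hP hσP 𝔔 h𝔔)).inertia
      (LangASCover W p g₁ ≃ₐ[W.toAffine.FunctionField] LangASCover W p g₁) = ⊥ := by
  haveI : NeZero p := ⟨(Fact.out : p.Prime).ne_zero⟩
  have hQP := liesOver_of_restrict_eq W p g₁ σ hσ hP hσP 𝔔 h𝔔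
  refine PlaceOver.inertia_eq_bot_of_forall _ _ fun θ hθQ hθ1 => ?_
  have hiff : ∀ w : LangASCover W p g₁, θ w ∈ 𝔔.toValuationSubring ↔ w ∈ 𝔔.toValuationSubring := fun w => by
    have h := PlaceOver.mem_comapRingEquiv_iff (θ : LangASCover W p g₁ ≃+* LangASCover W p g₁) 𝔔 w
    rw [hθQ] at h
    exact h.symm
  -- (1) the Lang component is trivial
  have hlang : (langComp W p g₁ θ).toAdd = 0 := by
    refine transl_eq_zero_of_forall W hP ?_ ?_
    · refine PlaceOver.eq_of_le fun z hz => ?_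
      rw [PlaceOver.mem_comapRingEquiv_iff] at hz
      rw [← h𝔔, PlaceOver.mem_restrict_iff] at hz ⊢
      change algebraMap (LangCover W) (LangASCover W p g₁) (LangCover.transl W (langComp W p g₁ θ).toAdd z) ∈ _ at hz
      rw [← apply_algebraMap, hiff] at hz
      exact hz
    · intro y hy
      rw [← h𝔔] at hy ⊢
      rw [PlaceOver.valuation_restrict_lt_one_iff, map_sub]
      change 𝔔.valuation (algebraMap (LangCover W) (LangASCover W p g₁)
        (LangCover.transl W (langComp W p g₁ θ).toAdd y) - _) < 1
      rw [← apply_algebraMap]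
      exact hθ1 _ ((PlaceOver.mem_restrict_iff _ _).1 hy)
  -- (2) the Artin–Schreier component is trivial
  have has : asComp W p g₁ θ = 1 := by
    set c := (asComp W p g₁ θ).toAdd with hc
    have hgen : gen W p g₁ ∈ 𝔔.toValuationSubring := gen_mem W p g₁ 𝔔 ((hQP g₁).2 hg)
    have h1 := hθ1 _ hgen
    rw [apply_gen, add_sub_cancel_left] at h1
    -- `(c.val : L)` is a constant: a unit unless `c.val = 0`
    by_contra hne
    have hcval : c.val ≠ 0 := fun h0 => hne (by
      have : c = 0 := (ZMod.val_eq_zero c).1 h0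
      exact Multiplicative.toAdd.injective this)
    have hcast : ((c.val : ℕ) : LangASCover W p g₁) ≠ 0 := by
      intro h0
      have := (CharP.cast_eq_zero_iff (LangASCover W p g₁) p c.val).1 h0
      exact hcval (Nat.eq_zero_of_dvd_of_lt this (ZMod.val_lt c))
    have hunit : 𝔔.valuation ((c.val : ℕ) : LangASCover W p g₁) = 1 := by
      have hF : ((c.val : ℕ) : F) ≠ 0 := fun h0 => hcast (by rw [← map_natCast (algebraMap F (LangASCover W p g₁)), h0, map_zero])
      rw [← map_natCast (algebraMap F (LangASCover W p g₁))]
      exact PlaceOver.valuation_algebraMap_eq_one 𝔔 hF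
    rw [hunit] at h1
    exact lt_irrefl _ h1
  -- conclude
  rw [eq_sigma W p g₁ θ, hlang, show (asComp W p g₁ θ).toAdd = 0 by rw [has]; rfl, sigma_zero]

set_option synthInstance.maxHeartbeats 400000 in
include hσ in
/-- **The Frobenius element of `L/k(W)` at a place `𝔔` above the finite place `v` below
`ϖ(P) = σP - P` is `σ_{(T_v, Tr_{κ(v)/𝔽_p} g₁(v))}`** — Lang component the Lang–Artin point `T_v`,
Artin–Schreier component the absolute trace of `g₁(v)`. [cite: KohelShparlinski2000, §2]
[cite: Stichtenoth2009, Thm. 3.8.2] -/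
theorem frob_eq_sigma {P : W.geomPoints} (hP : P ≠ 0) (hσP : σ • P ≠ P)
    (𝔔 : PlaceOver F (LangASCover W p g₁))
    (h𝔔 : 𝔔.restrict (K := F) (F := LangCover W) = coverPlace W P)
    (hg : g₁ ∈ (belowPlace W (σ • P - P)).toValuationSubring)
    [Algebra (ZMod p) (belowPlace W (σ • P - P)).residueField] :
    PlaceOver.frob 𝔔 (liesOver_of_restrict_eq W p g₁ σ hσ hP hσP 𝔔 h𝔔) =
      sigma W p g₁ (langPt W σ hσ (belowPlace W (σ • P - P)))
        (Algebra.trace (ZMod p) (belowPlace W (σ • P - P)).residueField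
          (IsLocalRing.residue _ ⟨g₁, hg⟩)) := by
  have hQP := liesOver_of_restrict_eq W p g₁ σ hσ hP hσP 𝔔 h𝔔
  set θ := PlaceOver.frob 𝔔 hQP with hθ
  -- the Lang component via restriction to the Lang cover
  have hIM : (PlaceOver.primeBelow (𝔔.restrict (K := F) (F := LangCover W))
      (PlaceOver.forall_mem_restrict_iff 𝔔 hQP)).inertia
        (LangCover W ≃ₐ[W.toAffine.FunctionField] LangCover W) = ⊥ := by
    rw [PlaceOver.primeBelow_congr h𝔔 _ (coverPlace_liesOver W σ hσ hP hσP)]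
    exact inertia_coverPlace_eq_bot W σ hσ hP hσP
  have hres := PlaceOver.restrictNormal_frob (M := LangCover W) 𝔔 hQP hIM
  rw [PlaceOver.frob_congr h𝔔 _ (coverPlace_liesOver W σ hσ hP hσP),
    frob_coverPlace_eq_transl_langPt W σ hσ hP hσP, ← hθ, restrictNormal_eq] at hres
  have hlang : (langComp W p g₁ θ).toAdd = langPt W σ hσ (belowPlace W (σ • P - P)) :=
    LangCover.transl_injective W hres
  -- the Artin–Schreier component
  have has := asComp_frob W p g₁ hg 𝔔 hQP
  rw [← hθ] at has
  rw [eq_sigma W p g₁ θ, hlang, has, toAdd_ofAdd]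

end Frobenius

/-! ### The full constant field of `L` -/

section ConstantField

/-- **`k` is the full constant field of `L`** when `λ g₁` has a pole of order prime to `p` at the
place at infinity: the place of `L` above the rational place `∞` of the Lang cover `k(W)` is totally
ramified (`ϑ^p - ϑ = λ g₁`, Stichtenoth Prop. 3.7.8), hence rational, and a function field with a
rational place has no new constants. [cite: Stichtenoth2009, Prop. 3.7.8] -/
theorem isIntegrallyClosedIn {m : ℕ} (hm : 0 < m) (hcop : Nat.Coprime m p)
    (hord : (WeierstrassPlaceAtInfinity.infPlace W.toAffine).ord (lam W g₁) = -m) :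
    IsIntegrallyClosedIn F (LangASCover W p g₁) := by
  have hp : p.Prime := Fact.out
  -- the rational place `∞` of the Lang cover and a place of `L` above it
  set P₀ : PlaceOver F (LangCover W) := coverPlace W 0 with hP₀
  obtain ⟨𝔔, h𝔔⟩ := PlaceOver.exists_restrict_eq' (K := F) (F' := LangASCover W p g₁) P₀
  have hdeg : P₀.degree = 1 := by
    rw [hP₀]
    change (belowPlace W 0).degree = 1
    rw [belowPlace_zero]
    exact WeierstrassPlaceAtInfinity.degree_infPlace W.toAffine
  have hw : P₀.ord (algebraMap W.toAffine.FunctionField (LangCover W) g₁) = -m := by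
    rw [hP₀]
    change (belowPlace W 0).ord (lam W g₁) = -m
    rw [belowPlace_zero]
    exact hord
  have htot := PlaceOver.totallyRamified_of_pow_sub_eq_of_coprime h𝔔 hp.two_le hm hcop
    (Literature.FieldTheory.ArtinSchreier.finrank_eq (K := LangCover W) (p := p)
      (c := algebraMap W.toAffine.FunctionField (LangCover W) g₁)).le
    (root_pow_sub_root (K := LangCover W) (p := p)
      (c := algebraMap W.toAffine.FunctionField (LangCover W) g₁)) hw
  have hrat : 𝔔.IsRational := by
    change 𝔔.degree = 1
    rw [htot.2.2.2.2, hdeg]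
  exact isIntegrallyClosedIn_of_isRational hrat

end ConstantField

end LangASCover

end Literature.NumberTheory.EllipticCurves.LangTorsor
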